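import Summits.ABC.IUTFork.Joshi.TestATS4WildBoundLpGenuine
import HarnessLib

/-!
# R-J census, row Y-21x, word ⟨WildBoundLp⟩: Joshi's [J-IV] Thm. 4.6.1 (5)-shaped input `MainBoundDatum.WildBoundLp` DECIDED on
# genuine number-field towers of the shape the tree's Step (ii) route quantifies over — FALSE on `ℚ ⊊ K ⊊ ℚ(ζ_ℓ)`, TRUE on `ℚ ⊆ ℚ(ζ_ℓ)`

Proof-only test file of the abc-iut cell (block E, R-J «Joshi Y-discharge census», rung LADDER-ABC:A2.RESCUE.J; seat abc-iut-E-t28,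
sub-claim Y-21x/MBD3; census-memo half: `HOME/plan/E/R-J/census-t6-Y21x-t28share.tsv`, E-t6). **No side is taken** on [IUTchIII]
Cor. 3.12, on [IUTchIV] Thm. 1.10, on Joshi's claims or on Mochizuki's reports on them; the source [J-IV] = arXiv:2403.10430v2 is an
unrefereed preprint; typed ≠ proved ≠ endorsed; NO abc claim. The mathematics below is classical (Dedekind–Hilbert ramification theory
of `ℚ(ζ_ℓ)` and its subfields, Mathlib's `IsCyclotomicExtension.Rat.*`); locators «p.N l.M» refer to the cell's render
`HOME/lit/renders/Joshi-arxiv-2403.10430/` (v2).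

## The item

`MainBoundDatum.WildBoundLp` (`Joshi/ATS4MainBounds.lean`, slot T-30) types the INPUT of [J-IV] Lem. 6.4.2 as its proof uses it
(p.60 l.22–30: «L′/L is tamely ramified outside {ℓ}, and as [L′ : L] ≤ ℓ⁴ by Lemma 6.3.2, one obtains the bound log([L′ : L]) ≤
4·log(ℓ) for the wild ramification term at ℓ in Theorem 4.6.1»), i.e. Thm. 4.6.1 (5) (p.46 l.42–46 «(log d_M + log f_M) − (log d_L +
log f_L) ≤ #S^ℚ_wild·log[M : L]») for `M = L′ ⊇ L` with `#S^ℚ_wild = 1`: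
`(log d^{L′} + log f^{L′}) − (log d^L + log f^L) ≤ 1·log[L′ : L]`.
State of the tree before this file (census word of record, E-t6 2026-08-26): NOT DERIVED and NOT NEEDED — Lem. 6.4.2 (1)(2) are
PROVED at genuine data directly (`MainBoundDatum.ofGenuine_lem642a/b`, p439256; `thetaTower_lem642a/b`, p440894) from the tree's
kernel form of [IUTchIV] Step (ii) (`+2·log ℓ`), bypassing `WildBoundLp`; the field-level ∀-form of (5) is KERNEL-FALSE
(`LogDiffCond.not_forall_wildBound`, p440196, witness `ℚ(ζ₃)/ℚ` with `S_wild = ∅`) and TRUE under the presupposition «unramified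
outside `V^{odd,ss}`» (`wildBound_of_unramifiedOutside`), which does not cover `L′ = L(E_L[ℓ])/L`.

## What this file decides (numbers, not adjectives)

Let `ℓ ≥ 5` be prime and consider GENUINE data of exactly the shape over which p439256 proves Lem. 6.4.2 (1)(2)
(`MainBoundDatum.ofGenuine_sharp642`: `L′/L` Galois, `[L′:L] ∣ ℓ(ℓ−1)²(ℓ+1)` = `|GL₂(𝔽_ℓ)|`, `Supp(𝔮_{L′})` the fibre of `Supp(𝔮_L)`
(T-26's `TateDivisorDatum.IsBaseChangeOf`), `L′/L` unramified at residue characteristic `≠ ℓ` off `Supp 𝔮_L` and tame there on it,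
`log(𝔮_L) > 0`). Take `L_tpd = L = ℚ`, `𝔮` supported at the prime over `2 ≠ ℓ` with local height `1`, and `L′ = K` a number field
inside `ℚ(ζ_ℓ)` with the fibred datum `𝔮_K`. Then (§2–§5):
* `K/ℚ` is unramified at every place of residue characteristic `≠ ℓ` and TOTALLY ramified at `ℓ` with index `[K:ℚ]`
  (`ramificationIdx_int_eq_one_of_residueChar_ne'`, `ramificationIdx_int_eq_finrank_of_residueChar_eq`: multiplicativity of `e` in
  `ℚ ⊆ K ⊆ ℚ(ζ_ℓ)` against Mathlib's `e = ℓ − 1` / `e = 1` for `ℚ(ζ_ℓ)`), hence `𝔭^{[K:ℚ]−1} ∣ 𝔡_{K/ℤ}` (Mathlib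
  `pow_sub_one_dvd_differentIdeal`) and **`log(d^K) ≥ (1 − 1/[K:ℚ])·log ℓ`** (`finrank_sub_one_mul_log_le_finrank_mul_logDifferent`);
* the conductor terms agree (`log f^K = log f^ℚ = log 2`: local heights `1`, unramified fibre, T-26's Prop. 4.4.4 `prop444`) and
  `log(d^ℚ) = 0`, so **`Δ := (log d^{L′} + log f^{L′}) − (log d^L + log f^L) = log(d^K)`** (`delta_eq_logDifferent`);
* **COUNTERMODEL** (`not_wildBoundLp_ofGenuine`): if `2 ≤ [K:ℚ]` and `2·[K:ℚ] + 1 ≤ ℓ` — i.e. for EVERY intermediate field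
  `ℚ ⊊ K ⊊ ℚ(ζ_ℓ)` — then `Δ ≥ (1 − 1/d)·log ℓ > log d = 1·log[L′:L]` (`d^d < ℓ^{d−1}`, `pow_self_lt_pow_pred`), so `WildBoundLp` is
  FALSE; such `K` exist for every `ℓ ≥ 5`: the fixed field of an order-`2` automorphism of `ℚ(ζ_ℓ)`, `[K:ℚ] = (ℓ−1)/2`, Galois over `ℚ`
  since `Gal(ℚ(ζ_ℓ)/ℚ)` is abelian (`exists_genuine_sharp642Hyps_not_wildBoundLp`); in the `¬ ∀` form over all towers satisfying the
  hypotheses of `ofGenuine_sharp642` VERBATIM: `not_forall_sharp642Hyps_wildBoundLp`;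
* **POSITIVE INSTANCES** under the SAME hypotheses: `L′ = ℚ(ζ_ℓ)` itself gives `Δ = log(d^{ℚ(ζ_ℓ)}) = ((ℓ−2)/(ℓ−1))·log ℓ ≤ log(ℓ−1) =
  log[L′:L]` (Mathlib `IsCyclotomicExtension.Rat.discr_prime`; `wildBoundLp_ofGenuine_cyclotomic`, `exists_genuine_sharp642Hyps_wildBoundLp`),
  and the trivial step `L′ = L` gives `0 ≤ 0` (`wildBoundLp_ofGenuine_self`) — the member `K = F`, `ψ = id` of p440894's family
  `thetaTower_*` (`F_tpd ⊆ F ⊆ K ⊆ F(E_F[ℓ])`).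

CENSUS READING (word ⟨WildBoundLp⟩, unchanged class LOCATED / BYPASSED): at genuine Galois data of `GL₂(𝔽_ℓ)`-degree type the predicate is
NOT a consequence of the hypotheses the tree's Step (ii) route uses — it holds or fails with the intermediate field (pure cyclotomic steps:
`≤`; proper sub-cyclotomic steps of degree `< ℓ/2`: `>`); the spine does not read it (`thm611_left_of_lem642b`). The LITERAL theta-tower
family of p440894 (`K ⊆ F(E_F[ℓ])` through the kernel condition `hK`) is inhabited on the positive side by `K = F`; a negative member would
need a certified PROPER subfield of `F(E_F[ℓ])/F` such as `F·ℚ(ζ_ℓ)⁺` — i.e. `μ_ℓ ⊂ F(E_F[ℓ])` (Weil pairing), which neither Mathlib nor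
the tree has at this snapshot (only `ζ₃ ∈ F(x(E[3]))`, `zeta_mem_and_delta_mem_xDivisionField_three`): UNDECIDED-IN-TREE for `K ≠ F`,
and on paper instance-dependent (for `K = F(E_F[ℓ])` it holds iff `log[K:F]` outgrows the wild different share at `ℓ`, at most
`2·log ℓ + log 2`). FACT-LIST rows used: none. Theorems only (no `def`, no `instance`, no notation, no new `Prop` fact); standard axioms;
no `sorry`. [claim: Joshi2024ATS4, status: disputed] (provenance of the typed item `WildBoundLp`; nothing of the paper is asserted or
endorsed here).
-/

noncomputable section

open NumberField IsDedekindDomain Module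
open Literature.IUT.LogVolume

namespace Summit.ABC.IUTFork.Joshi.ATS4

namespace WildBoundLpCensus

/-! ## 5. The census decision on the sub-cyclotomic towers `ℚ ⊆ K ⊆ ℚ(ζ_ℓ)` -/

section Census

variable {ℓ : ℕ} [hℓ : Fact ℓ.Prime] (M : Type*) [Field M] [NumberField M] [IsCyclotomicExtension {ℓ} ℚ M]
variable (K : Type*) [Field K] [NumberField K] [Algebra K M]
variable (𝔮 : TateDivisorDatum ℚ) (𝔮K : TateDivisorDatum K)

include M in
/-- `K/ℚ` is unramified at every place of residue characteristic `≠ ℓ`, in the currency of `MainBoundDatum.ofGenuine_sharp642`'s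
hypotheses (`e` over `𝓞 ℚ`). [folklore] -/
theorem ramificationIdx_ringOfIntegers_rat_eq_one (u : HeightOneSpectrum (𝓞 K)) (hu : residueChar K u ≠ ℓ) :
    u.asIdeal.ramificationIdx (𝓞 ℚ) = 1 := by
  rw [← LogDiffCond.relRamIdx_eq ℚ K u, LogDiffCond.relRamIdx_rat_eq K u]
  exact ramificationIdx_int_eq_one_of_residueChar_ne' ℓ M K u hu

include M in
/-- On a fibred support away from `ℓ` the tower `K/ℚ` is unramified (T-26's `relRamIdx = 1`). [folklore] -/
theorem relRamIdx_eq_one_of_mem (hV : ∀ u, u ∈ 𝔮K.V ↔ finBelow ℚ K u ∈ 𝔮.V) (hVℓ : ∀ v ∈ 𝔮.V, residueChar ℚ v ≠ ℓ)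
    (u : HeightOneSpectrum (𝓞 K)) (hu : u ∈ 𝔮K.V) : relRamIdx ℚ K u = 1 := by
  have hres : residueChar K u ≠ ℓ := by
    rw [← residueChar_finBelow (F := ℚ) (K := K) u]; exact hVℓ _ ((hV u).mp hu)
  -- T-26's `relRamIdx` is Mathlib's `Ideal.ramificationIdx` over `𝓞 ℚ` (as in `ATS4RamificationLegendre.relRamIdx_eq_ramificationIdx`)
  haveI : u.asIdeal.IsPrime := u.isPrime
  rw [relRamIdx, Ideal.ramificationIdx'_eq_ramificationIdx (p := (finBelow ℚ K u).asIdeal) (q := u.asIdeal)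
    (finBelow ℚ K u).ne_bot]
  exact ramificationIdx_ringOfIntegers_rat_eq_one (ℓ := ℓ) M K u hres

include M in
/-- **The difference `Δ = (log d^{L′} + log f^{L′}) − (log d^L + log f^L)` of the tower `L = ℚ ⊆ L′ = K ⊆ ℚ(ζ_ℓ)` is `log(d^K)`** (the
conductor terms agree and `log(d^ℚ) = 0`). [folklore] -/
theorem delta_eq_logDifferent (hV : ∀ u, u ∈ 𝔮K.V ↔ finBelow ℚ K u ∈ 𝔮.V) (h1 : ∀ v ∈ 𝔮.V, 𝔮.ordq v = 1)
    (h1K : ∀ u ∈ 𝔮K.V, 𝔮K.ordq u = 1) (hVℓ : ∀ v ∈ 𝔮.V, residueChar ℚ v ≠ ℓ) :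
    (logDifferent K + 𝔮K.logf) - (logDifferent ℚ + 𝔮.logf) = logDifferent K := by
  rw [logf_eq_logf_of_relRamIdx_eq_one 𝔮 𝔮K hV h1 h1K (relRamIdx_eq_one_of_mem (ℓ := ℓ) M K 𝔮 𝔮K hV hVℓ),
    logDifferent_rat]
  ring

include M in
/-- **COUNTERMODEL.** For `2 ≤ [K:ℚ]` and `2·[K:ℚ] + 1 ≤ ℓ` (every intermediate field `ℚ ⊊ K ⊊ ℚ(ζ_ℓ)`), Joshi's input `WildBoundLp`
— «(log d^{L′} + log f^{L′}) − (log d^L + log f^L) ≤ 1·log[L′:L]», [J-IV] Thm. 4.6.1 (5) with `#S^ℚ_wild = 1` (p.46 l.42–46; used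
p.60 l.22–30) — FAILS for the genuine datum `MainBoundDatum.ofGenuine ℚ … 𝔮 𝔮 𝔮K` of the tower `L_tpd = L = ℚ ⊆ L′ = K`:
`Δ = log(d^K) ≥ (1 − 1/[K:ℚ])·log ℓ > log[K:ℚ]`. [claim: Joshi2024ATS4, status: disputed] -/
theorem not_wildBoundLp_ofGenuine [IsScalarTower ℚ K M] (hV : ∀ u, u ∈ 𝔮K.V ↔ finBelow ℚ K u ∈ 𝔮.V)
    (h1 : ∀ v ∈ 𝔮.V, 𝔮.ordq v = 1) (h1K : ∀ u ∈ 𝔮K.V, 𝔮K.ordq u = 1) (hVℓ : ∀ v ∈ 𝔮.V, residueChar ℚ v ≠ ℓ)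
    (hℓ' : ℓ.Prime) (h5 : 5 ≤ ℓ) (hq : 0 < 𝔮.logq) (hd : 2 ≤ Module.finrank ℚ K)
    (hdℓ : 2 * Module.finrank ℚ K + 1 ≤ ℓ) :
    ¬ (MainBoundDatum.ofGenuine ℚ hℓ' h5 𝔮 𝔮 𝔮K hq).WildBoundLp := by
  intro h
  unfold MainBoundDatum.WildBoundLp at h
  change (logDifferent K + 𝔮K.logf) - (logDifferent ℚ + 𝔮.logf) ≤ 1 * Real.log (Module.finrank ℚ K : ℕ) at h
  rw [delta_eq_logDifferent M K 𝔮 𝔮K hV h1 h1K hVℓ, one_mul] at h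
  have hlow := finrank_sub_one_mul_log_le_finrank_mul_logDifferent ℓ M K
  have hlt := mul_log_lt_sub_one_mul_log hd hdℓ
  have hd0 : (0 : ℝ) < Module.finrank ℚ K := by exact_mod_cast (by omega : 0 < Module.finrank ℚ K)
  have h' : (Module.finrank ℚ K : ℝ) * logDifferent K ≤ Module.finrank ℚ K * Real.log (Module.finrank ℚ K : ℕ) :=
    mul_le_mul_of_nonneg_left h hd0.le
  linarith

end Census

/-! ## 6. The dividing line: the full cyclotomic step `L′ = ℚ(ζ_ℓ)` SATISFIES `WildBoundLp` -/

section Top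

variable (ℓ : ℕ) [hℓ : Fact ℓ.Prime] (M : Type*) [Field M] [NumberField M] [IsCyclotomicExtension {ℓ} ℚ M]
variable (𝔮 : TateDivisorDatum ℚ) (𝔮M : TateDivisorDatum M)

/-- `log(d^{ℚ(ζ_ℓ)}) = ((ℓ − 2)/(ℓ − 1))·log ℓ` (Mathlib: `|disc ℚ(ζ_ℓ)| = ℓ^{ℓ−2}`). [folklore] -/
theorem logDifferent_cyclotomic : logDifferent M = ((ℓ : ℝ) - 2) * Real.log ℓ / ((ℓ : ℝ) - 1) := by
  haveI : NeZero ℓ := ⟨hℓ.out.ne_zero⟩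
  rw [logDifferent_eq_log_discr, IsCyclotomicExtension.Rat.discr_prime ℓ M, finrank_rat_eq ℓ M]
  have h2 : 2 ≤ ℓ := hℓ.out.two_le
  rw [Int.natAbs_mul, Int.natAbs_pow, Int.natAbs_pow]
  simp only [Int.natAbs_neg, Int.natAbs_one, one_pow, one_mul, Int.natAbs_natCast]
  push_cast
  rw [Real.log_pow, Nat.cast_sub h2, Nat.cast_sub (by omega : 1 ≤ ℓ)]
  norm_num

/-- **POSITIVE INSTANCE.** For `L′ = ℚ(ζ_ℓ)` itself (`ℓ ≥ 5`) Joshi's `WildBoundLp` HOLDS for the genuine datum of `ℚ ⊆ ℚ(ζ_ℓ)`: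
`Δ = log(d^{ℚ(ζ_ℓ)}) = ((ℓ−2)/(ℓ−1))·log ℓ ≤ log(ℓ − 1) = log[ℚ(ζ_ℓ):ℚ]`. [claim: Joshi2024ATS4, status: disputed] -/
theorem wildBoundLp_ofGenuine_cyclotomic (hV : ∀ u, u ∈ 𝔮M.V ↔ finBelow ℚ M u ∈ 𝔮.V) (h1 : ∀ v ∈ 𝔮.V, 𝔮.ordq v = 1)
    (h1M : ∀ u ∈ 𝔮M.V, 𝔮M.ordq u = 1) (hVℓ : ∀ v ∈ 𝔮.V, residueChar ℚ v ≠ ℓ)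
    (hℓ' : ℓ.Prime) (h5 : 5 ≤ ℓ) (hq : 0 < 𝔮.logq) :
    (MainBoundDatum.ofGenuine ℚ hℓ' h5 𝔮 𝔮 𝔮M hq).WildBoundLp := by
  unfold MainBoundDatum.WildBoundLp
  change (logDifferent M + 𝔮M.logf) - (logDifferent ℚ + 𝔮.logf) ≤ 1 * Real.log (Module.finrank ℚ M : ℕ)
  rw [delta_eq_logDifferent (ℓ := ℓ) M M 𝔮 𝔮M hV h1 h1M hVℓ, one_mul, logDifferent_cyclotomic ℓ M, finrank_rat_eq ℓ M,
    Nat.cast_sub hℓ'.one_le, Nat.cast_one]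
  have hℓ1 : (0 : ℝ) < (ℓ : ℝ) - 1 := by
    have : (5 : ℝ) ≤ ℓ := by exact_mod_cast h5
    linarith
  rw [div_le_iff₀ hℓ1, mul_comm (Real.log _)]
  exact sub_two_mul_log_le (by omega)

/-- **The trivial step `L′ = L` satisfies `WildBoundLp`** (`Δ = 0 ≤ 1·log 1 = 0`) — for any base and data; in particular the member `K = F`
(`ψ = id`) of the genuine theta-tower family of `Joshi/ATS4MainBoundsGenuineTheta.lean` (p440894). [claim: Joshi2024ATS4, status: disputed] -/
theorem wildBoundLp_ofGenuine_self (Lmod : Type*) [Field Lmod] [NumberField Lmod] {Ltpd L : Type*} [Field Ltpd] [NumberField Ltpd]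
    [Field L] [NumberField L] [Algebra Ltpd L] {ℓ : ℕ} (hℓ' : ℓ.Prime) (h5 : 5 ≤ ℓ) (𝔮tpd : TateDivisorDatum Ltpd)
    (𝔮L : TateDivisorDatum L) (hq : 0 < 𝔮L.logq) :
    (MainBoundDatum.ofGenuine Lmod hℓ' h5 𝔮tpd 𝔮L 𝔮L hq).WildBoundLp := by
  unfold MainBoundDatum.WildBoundLp
  change (logDifferent L + 𝔮L.logf) - (logDifferent L + 𝔮L.logf) ≤ 1 * Real.log (Module.finrank L L : ℕ)
  rw [sub_self, Module.finrank_self, Nat.cast_one, Real.log_one, mul_zero]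

end Top

/-! ## 7. Inhabiting the countermodel: the fixed field of an automorphism of order `2` of `ℚ(ζ_ℓ)`, `[K:ℚ] = (ℓ−1)/2` -/

section Witness

/-- **For every prime `ℓ ≥ 5` there are GENUINE data satisfying every side condition under which the tree PROVES Lem. 6.4.2 (1)(2)
(`MainBoundDatum.ofGenuine_sharp642` / `ofGenuine_lem642a`: `L′/L` Galois, `[L′:L] ∣ ℓ(ℓ−1)²(ℓ+1)`, fibred supports in T-26's
base-change relation, `L′/L` unramified at residue characteristic `≠ ℓ` — a fortiori off `Supp 𝔮` and tame on it —, `log(𝔮_L) > 0`)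
at which Joshi's input `WildBoundLp` is FALSE**: `L_tpd = L = ℚ`, `L′ = K` the fixed field of an order-`2` automorphism of `ℚ(ζ_ℓ)`
(`[K:ℚ] = (ℓ−1)/2`), `𝔮` supported at one prime over `2 ≠ ℓ` with `ord = 1`, `𝔮_K` its fibre. [claim: Joshi2024ATS4, status: disputed] -/
theorem exists_genuine_sharp642Hyps_not_wildBoundLp {ℓ : ℕ} (hℓ' : ℓ.Prime) (h5 : 5 ≤ ℓ) :
    ∃ (K : Type) (_ : Field K) (_ : NumberField K) (_ : IsGalois ℚ K)
      (𝔮 : TateDivisorDatum ℚ) (𝔮K : TateDivisorDatum K) (hq : 0 < 𝔮.logq),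
      2 * Module.finrank ℚ K = ℓ - 1 ∧
      𝔮K.IsBaseChangeOf 𝔮 ∧
      Module.finrank ℚ K ∣ ℓ * (ℓ - 1) ^ 2 * (ℓ + 1) ∧
      (∀ u : HeightOneSpectrum (𝓞 K), residueChar K u ≠ ℓ → u.asIdeal.ramificationIdx (𝓞 ℚ) = 1) ∧
      ¬ (MainBoundDatum.ofGenuine ℚ hℓ' h5 𝔮 𝔮 𝔮K hq).WildBoundLp := by
  classical
  haveI : Fact ℓ.Prime := ⟨hℓ'⟩
  haveI : NeZero ℓ := ⟨hℓ'.ne_zero⟩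
  haveI : IsCyclotomicExtension {ℓ} ℚ (CyclotomicField ℓ ℚ) := CyclotomicField.isCyclotomicExtension ℓ ℚ
  haveI : IsGalois ℚ (CyclotomicField ℓ ℚ) := IsCyclotomicExtension.isGalois {ℓ} ℚ (CyclotomicField ℓ ℚ)
  -- an automorphism of order `2` of `ℚ(ζ_ℓ)` and its fixed field `Kf`, `[ℚ(ζ_ℓ) : Kf] = 2`, `2·[Kf : ℚ] = ℓ − 1`
  obtain ⟨σ, hσ⟩ := exists_orderOf_eq_two ℓ (CyclotomicField ℓ ℚ) (by omega)
  haveI : (Subgroup.zpowers σ).Normal := zpowers_normal ℓ (CyclotomicField ℓ ℚ) σ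
  set Kf : IntermediateField ℚ (CyclotomicField ℓ ℚ) := IntermediateField.fixedField (Subgroup.zpowers σ) with hKf
  haveI : IsGalois ℚ Kf := IsGalois.of_fixedField_normal_subgroup (Subgroup.zpowers σ)
  have hKM : Module.finrank Kf (CyclotomicField ℓ ℚ) = 2 := by
    rw [hKf, IntermediateField.finrank_fixedField_eq_card, Nat.card_zpowers, hσ]
  have hdeg : 2 * Module.finrank ℚ Kf = ℓ - 1 := by
    rw [mul_comm, ← hKM, Module.finrank_mul_finrank, finrank_rat_eq ℓ (CyclotomicField ℓ ℚ)]
  have hd2 : 2 ≤ Module.finrank ℚ Kf := by omega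
  have hdℓ : 2 * Module.finrank ℚ Kf + 1 ≤ ℓ := by omega
  -- the auxiliary bad place: the prime of `ℚ` over `2 ≠ ℓ`; Tate data with `ord = 1` there and on its fibre in `Kf`
  obtain ⟨v, hv⟩ := exists_residueChar_eq ℚ Nat.prime_two
  let 𝔮 : TateDivisorDatum ℚ := ⟨{v}, fun _ => 1, fun _ _ => Nat.one_pos⟩
  let 𝔮K : TateDivisorDatum Kf :=
    ⟨(IsDedekindDomain.primesOverFinset v.asIdeal (𝓞 Kf)).preimage HeightOneSpectrum.asIdeal
        (fun _ _ _ _ h => HeightOneSpectrum.ext h), fun _ => 1, fun _ _ => Nat.one_pos⟩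
  have hV : ∀ u, u ∈ 𝔮K.V ↔ finBelow ℚ Kf u ∈ 𝔮.V := fun u =>
    (mem_preimage_primesOverFinset_iff v u).trans Finset.mem_singleton.symm
  have h1 : ∀ v' ∈ 𝔮.V, 𝔮.ordq v' = 1 := fun _ _ => rfl
  have h1K : ∀ u ∈ 𝔮K.V, 𝔮K.ordq u = 1 := fun _ _ => rfl
  have hVℓ : ∀ v' ∈ 𝔮.V, residueChar ℚ v' ≠ ℓ := by
    intro v' hv'
    have hv'v : v' = v := Finset.mem_singleton.mp hv'
    rw [hv'v, hv]
    omega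
  have hq : 0 < 𝔮.logq := logq_pos_of_nonempty 𝔮 (Finset.singleton_nonempty v)
  have hbc : 𝔮K.IsBaseChangeOf 𝔮 :=
    isBaseChangeOf_of_relRamIdx_eq_one 𝔮 𝔮K hV h1 h1K
      (relRamIdx_eq_one_of_mem (ℓ := ℓ) (CyclotomicField ℓ ℚ) Kf 𝔮 𝔮K hV hVℓ)
  refine ⟨Kf, inferInstance, inferInstance, inferInstance, 𝔮, 𝔮K, hq, hdeg, hbc, ?_, ?_, ?_⟩
  · -- `[Kf : ℚ] = (ℓ−1)/2` divides `ℓ·(ℓ−1)²·(ℓ+1)`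
    rw [← hdeg]
    exact ⟨ℓ * (4 * Module.finrank ℚ Kf) * (ℓ + 1), by ring⟩
  · exact fun u hu => ramificationIdx_ringOfIntegers_rat_eq_one (ℓ := ℓ) (CyclotomicField ℓ ℚ) Kf u hu
  · exact not_wildBoundLp_ofGenuine (CyclotomicField ℓ ℚ) Kf 𝔮 𝔮K hV h1 h1K hVℓ hℓ' h5 hq hd2 hdℓ

/-- **Under the SAME hypotheses `WildBoundLp` can also HOLD**: `L′ = ℚ(ζ_ℓ)` (`[L′:ℚ] = ℓ − 1`), same base and Tate data. So at genuine
Galois data of `GL₂(𝔽_ℓ)`-degree type the predicate is decided by the field, not by the hypotheses. [claim: Joshi2024ATS4, status: disputed] -/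
theorem exists_genuine_sharp642Hyps_wildBoundLp {ℓ : ℕ} (hℓ' : ℓ.Prime) (h5 : 5 ≤ ℓ) :
    ∃ (K : Type) (_ : Field K) (_ : NumberField K) (_ : IsGalois ℚ K)
      (𝔮 : TateDivisorDatum ℚ) (𝔮K : TateDivisorDatum K) (hq : 0 < 𝔮.logq),
      Module.finrank ℚ K = ℓ - 1 ∧
      𝔮K.IsBaseChangeOf 𝔮 ∧
      Module.finrank ℚ K ∣ ℓ * (ℓ - 1) ^ 2 * (ℓ + 1) ∧
      (∀ u : HeightOneSpectrum (𝓞 K), residueChar K u ≠ ℓ → u.asIdeal.ramificationIdx (𝓞 ℚ) = 1) ∧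
      (MainBoundDatum.ofGenuine ℚ hℓ' h5 𝔮 𝔮 𝔮K hq).WildBoundLp := by
  classical
  haveI : Fact ℓ.Prime := ⟨hℓ'⟩
  haveI : NeZero ℓ := ⟨hℓ'.ne_zero⟩
  haveI : IsCyclotomicExtension {ℓ} ℚ (CyclotomicField ℓ ℚ) := CyclotomicField.isCyclotomicExtension ℓ ℚ
  haveI : IsGalois ℚ (CyclotomicField ℓ ℚ) := IsCyclotomicExtension.isGalois {ℓ} ℚ (CyclotomicField ℓ ℚ)
  obtain ⟨v, hv⟩ := exists_residueChar_eq ℚ Nat.prime_two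
  let 𝔮 : TateDivisorDatum ℚ := ⟨{v}, fun _ => 1, fun _ _ => Nat.one_pos⟩
  let 𝔮M : TateDivisorDatum (CyclotomicField ℓ ℚ) :=
    ⟨(IsDedekindDomain.primesOverFinset v.asIdeal (𝓞 (CyclotomicField ℓ ℚ))).preimage HeightOneSpectrum.asIdeal
        (fun _ _ _ _ h => HeightOneSpectrum.ext h), fun _ => 1, fun _ _ => Nat.one_pos⟩
  have hV : ∀ u, u ∈ 𝔮M.V ↔ finBelow ℚ (CyclotomicField ℓ ℚ) u ∈ 𝔮.V := fun u =>
    (mem_preimage_primesOverFinset_iff v u).trans Finset.mem_singleton.symm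
  have h1 : ∀ v' ∈ 𝔮.V, 𝔮.ordq v' = 1 := fun _ _ => rfl
  have h1M : ∀ u ∈ 𝔮M.V, 𝔮M.ordq u = 1 := fun _ _ => rfl
  have hVℓ : ∀ v' ∈ 𝔮.V, residueChar ℚ v' ≠ ℓ := by
    intro v' hv'
    have hv'v : v' = v := Finset.mem_singleton.mp hv'
    rw [hv'v, hv]
    omega
  have hq : 0 < 𝔮.logq := logq_pos_of_nonempty 𝔮 (Finset.singleton_nonempty v)
  have hbc : 𝔮M.IsBaseChangeOf 𝔮 :=
    isBaseChangeOf_of_relRamIdx_eq_one 𝔮 𝔮M hV h1 h1M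
      (relRamIdx_eq_one_of_mem (ℓ := ℓ) (CyclotomicField ℓ ℚ) (CyclotomicField ℓ ℚ) 𝔮 𝔮M hV hVℓ)
  refine ⟨CyclotomicField ℓ ℚ, inferInstance, inferInstance, inferInstance, 𝔮, 𝔮M, hq,
    finrank_rat_eq ℓ (CyclotomicField ℓ ℚ), hbc, ?_, ?_, ?_⟩
  · rw [finrank_rat_eq ℓ (CyclotomicField ℓ ℚ)]
    exact ⟨ℓ * (ℓ - 1) * (ℓ + 1), by ring⟩
  · exact fun u hu =>
      ramificationIdx_ringOfIntegers_rat_eq_one (ℓ := ℓ) (CyclotomicField ℓ ℚ) (CyclotomicField ℓ ℚ) u hu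
  · exact wildBoundLp_ofGenuine_cyclotomic ℓ (CyclotomicField ℓ ℚ) 𝔮 𝔮M hV h1 h1M hVℓ hℓ' h5 hq

/-- **CENSUS FORM.** The hypotheses under which the tree PROVES [J-IV] Lem. 6.4.2 (1)(2) at genuine data — those of
`MainBoundDatum.ofGenuine_sharp642` VERBATIM (`L′/L` Galois, fibred supports, `[L′:L] ∣ ℓ(ℓ−1)²(ℓ+1)`, unramified at residue
characteristic `≠ ℓ` off `Supp 𝔮_L`, tame at residue characteristic `≠ ℓ` on it, `log(𝔮_L) > 0`; base `L_tpd = L`) — do NOT imply Joshi's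
input `WildBoundLp` (Thm. 4.6.1 (5) for `L′/L` with `#S^ℚ_wild = 1`, p.60 l.22–30), for any prime `ℓ ≥ 5`. Located, not adjudicated:
the printed conclusions Lem. 6.4.2 (1)(2) are unaffected (proved with `2·log ℓ + 21 ≤ 4·log ℓ + 33`). [claim: Joshi2024ATS4, status: disputed] -/
theorem not_forall_sharp642Hyps_wildBoundLp {ℓ : ℕ} (hℓ' : ℓ.Prime) (h5 : 5 ≤ ℓ) :
    ¬ ∀ (L L' : Type) [Field L] [NumberField L] [Field L'] [NumberField L'] [Algebra L L'] [IsGalois L L']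
        (𝔮L : TateDivisorDatum L) (𝔮L' : TateDivisorDatum L') (hq : 0 < 𝔮L.logq),
        (∀ u, u ∈ 𝔮L'.V ↔ finBelow L L' u ∈ 𝔮L.V) →
        Module.finrank L L' ∣ ℓ * (ℓ - 1) ^ 2 * (ℓ + 1) →
        (∀ u : HeightOneSpectrum (𝓞 L'), residueChar L' u ≠ ℓ → finBelow L L' u ∉ 𝔮L.V →
          u.asIdeal.ramificationIdx (𝓞 L) = 1) →
        (∀ u : HeightOneSpectrum (𝓞 L'), residueChar L' u ≠ ℓ → finBelow L L' u ∈ 𝔮L.V →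
          ¬ residueChar L' u ∣ u.asIdeal.ramificationIdx (𝓞 L)) →
        (MainBoundDatum.ofGenuine ℚ hℓ' h5 𝔮L 𝔮L 𝔮L' hq).WildBoundLp := by
  intro h
  obtain ⟨K, _, _, _, 𝔮, 𝔮K, hq, _, hbc, hdvd, hunr, hnot⟩ := exists_genuine_sharp642Hyps_not_wildBoundLp hℓ' h5
  exact hnot (h ℚ K 𝔮 𝔮K hq hbc.1 hdvd (fun u hu _ => hunr u hu)
    (fun u hu _ => by rw [hunr u hu]; exact (residueChar_prime K u).not_dvd_one))

end Witness

end WildBoundLpCensus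

end Summit.ABC.IUTFork.Joshi.ATS4

end
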